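import Literature.AlgebraicGeometry.Resolution.PolynomialDiffOpOrder
import HarnessLib

/-!
# `Diff^{≤ n}_{K[X]/K}` is spanned by the Hasse derivatives `D^{(0)}, …, D^{(n)}` (EGA IV₄ 16.11.2, one variable)

Topic: `Literature/AlgebraicGeometry/Resolution`. For any commutative ring `K`, every `K`-linear differential
operator `E` of order `≤ n` on `K[X]` (Grothendieck's sense, the tree's `IsDiffOpLE`) is the `K[X]`-combination
`E = Σ_{q ≤ n} a_q · D^{(q)}` of Mathlib's Hasse derivatives `Polynomial.hasseDeriv q`, with the coefficients
`a_q = hasseCoeff E q` obtained by the triangular solve `a_j = E(X^j) − Σ_{q<j} a_q D^{(q)}(X^j)`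
(`eq_sum_hasseCoeff_smul_hasseDeriv`). Consequently `Diff^{≤ n}_{K[X]/K} = Σ_{q ≤ n} K[X]·D^{(q)}`
(`diffOp_polynomial_eq_span`) and the differential ideals of the tree are computed on the Hasse derivatives:
`Diff^{≤ n}(I) ⊆ J ↔ D^{(q)} f ∈ J` for all `q ≤ n`, `f ∈ I` (`diffIdeal_polynomial_le_iff`).

This completes, for one variable, the generation half of EGA IV₄ Thm. 16.11.2 on top of
`PolynomialDiffOpOrder.lean` (res-type-072: `eq_zero_of_isDiffOpLE_of_apply_X_pow_eq_zero` — an operator of order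
`≤ n` is determined by its values on `1, X, …, X^n` — and `isDiffOpLE_polyHasseDeriv`). Used by the Hironaka-2017
adjudication cell (`res-hironaka`, G1 rows R87/R38: explicit computation of `℘̃(E,i) = Σ_d Diff^{(dm−i)}℘(E,dm)` on
the affine line in characteristic `p`); nothing about that manuscript is asserted here.

Source: [EGAIV4] A. Grothendieck, EGA IV₄, Thm. 16.11.2 (for a polynomial algebra the `D_q`, `|q| ≤ n`, form a
basis of the differential operators of order `≤ n`).
-/

noncomputable section

open Polynomial

namespace Literature.AlgebraicGeometry.Resolution

variable {K : Type*} [CommRing K]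

/-- **The Hasse coefficients of an endomorphism `E` of `K[X]`**: the unique solution of the unitriangular system
`E(X^j) = Σ_{q ≤ j} a_q · D^{(q)}(X^j)` (`D^{(j)}(X^j) = 1`, `D^{(q)}(X^j) = 0` for `q > j`), i.e.
`a_j = E(X^j) − Σ_{q < j} a_q · D^{(q)}(X^j)`. [cite: EGAIV4, Thm. 16.11.2 (coefficients of D in the basis D_q)] -/
def hasseCoeff (E : K[X] →ₗ[K] K[X]) : ℕ → K[X]
  | j => E (X ^ j) - ∑ q : Fin j, hasseCoeff E q.1 * hasseDeriv q.1 (X ^ j)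
  decreasing_by exact q.2

/-- The defining equation of the Hasse coefficients (range form). [cite: EGAIV4, Thm. 16.11.2] -/
theorem hasseCoeff_eq (E : K[X] →ₗ[K] K[X]) (j : ℕ) :
    hasseCoeff E j = E (X ^ j) - ∑ q ∈ Finset.range j, hasseCoeff E q * hasseDeriv q (X ^ j) := by
  rw [hasseCoeff, ← Fin.sum_univ_eq_sum_range (fun q => hasseCoeff E q * hasseDeriv q (X ^ j)) j]

/-- `D^{(q)}(X^j) = 0` for `q > j`. [cite: EGAIV4, Thm. 16.11.2 ((16.11.2.1): D_q(z^n) = (n choose q) z^{n−q})] -/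
theorem hasseDeriv_X_pow_eq_zero_of_lt {j q : ℕ} (h : j < q) : hasseDeriv q ((X : K[X]) ^ j) = 0 := by
  rw [X_pow_eq_monomial, hasseDeriv_monomial, Nat.choose_eq_zero_of_lt h, Nat.cast_zero, zero_mul,
    monomial_zero_right]

/-- **The expansion reproduces `E` on `1, X, …, X^n`**: `Σ_{q ≤ n} a_q · D^{(q)}(X^j) = E(X^j)` for `j ≤ n`.
[cite: EGAIV4, Thm. 16.11.2] -/
theorem sum_hasseCoeff_mul_hasseDeriv_X_pow (E : K[X] →ₗ[K] K[X]) {j n : ℕ} (hj : j ≤ n) :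
    ∑ q ∈ Finset.range (n + 1), hasseCoeff E q * hasseDeriv q ((X : K[X]) ^ j) = E (X ^ j) := by
  have hsplit : Finset.range (n + 1) = Finset.range (j + 1) ∪ Finset.Ico (j + 1) (n + 1) := by
    rw [Finset.range_eq_Ico, Finset.range_eq_Ico, Finset.Ico_union_Ico_eq_Ico (Nat.zero_le _) (by omega)]
  rw [hsplit, Finset.sum_union (by
    rw [Finset.range_eq_Ico]; exact Finset.Ico_disjoint_Ico_consecutive 0 (j + 1) (n + 1))]
  have hvanish : ∑ q ∈ Finset.Ico (j + 1) (n + 1), hasseCoeff E q * hasseDeriv q ((X : K[X]) ^ j) = 0 := by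
    refine Finset.sum_eq_zero fun q hq => ?_
    rw [Finset.mem_Ico] at hq
    rw [hasseDeriv_X_pow_eq_zero_of_lt (by omega), mul_zero]
  rw [hvanish, add_zero, Finset.sum_range_succ, polyHasseDeriv_X_pow_self, mul_one, hasseCoeff_eq]
  ring

/-- **EGA IV₄ 16.11.2 on the affine line (generation)**: a differential operator of order `≤ n` on `K[X]` is the
`K[X]`-combination `Σ_{q ≤ n} a_q · D^{(q)}` of Hasse derivatives, `a_q` its Hasse coefficients.
[cite: EGAIV4, Thm. 16.11.2 (every operator of order ≤ n is Σ_{|q| ≤ n} a_q D_q)] -/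
theorem eq_sum_hasseCoeff_smul_hasseDeriv {n : ℕ} {E : K[X] →ₗ[K] K[X]} (hE : IsDiffOpLE K n E) :
    E = ∑ q ∈ Finset.range (n + 1), hasseCoeff E q • (hasseDeriv q : K[X] →ₗ[K] K[X]) := by
  have hE' : IsDiffOpLE K n (∑ q ∈ Finset.range (n + 1), hasseCoeff E q • (hasseDeriv q : K[X] →ₗ[K] K[X])) :=
    IsDiffOpLE.sum _ fun q hq =>
      IsDiffOpLE.smul _ (isDiffOpLE_polyHasseDeriv n q (Nat.lt_succ_iff.mp (Finset.mem_range.mp hq)))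
  rw [← sub_eq_zero]
  refine eq_zero_of_isDiffOpLE_of_apply_X_pow_eq_zero n (hE.sub hE') fun j hj => ?_
  rw [LinearMap.sub_apply, LinearMap.sum_apply, sub_eq_zero]
  simp only [LinearMap.smul_apply, smul_eq_mul]
  exact (sum_hasseCoeff_mul_hasseDeriv_X_pow E hj).symm

/-- Hence the value `E f` is the same combination of the `D^{(q)} f`. [cite: EGAIV4, Thm. 16.11.2] -/
theorem apply_eq_sum_hasseCoeff_mul_hasseDeriv {n : ℕ} {E : K[X] →ₗ[K] K[X]} (hE : IsDiffOpLE K n E)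
    (f : K[X]) : E f = ∑ q ∈ Finset.range (n + 1), hasseCoeff E q * hasseDeriv q f := by
  conv_lhs => rw [eq_sum_hasseCoeff_smul_hasseDeriv hE]
  rw [LinearMap.sum_apply]
  simp only [LinearMap.smul_apply, smul_eq_mul]

/-- **`Diff^{≤ n}_{K[X]/K} = Σ_{q ≤ n} K[X] · D^{(q)}`** (the submodule of the tree's `diffOp` is the span of the
Hasse derivatives of order `≤ n`). [cite: EGAIV4, Thm. 16.11.2] -/
theorem diffOp_polynomial_eq_span (n : ℕ) :
    diffOp K K[X] n =
      Submodule.span K[X] ((fun q => (hasseDeriv q : K[X] →ₗ[K] K[X])) '' ↑(Finset.range (n + 1))) := by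
  refine le_antisymm (fun E hE => ?_) (Submodule.span_le.mpr ?_)
  · rw [eq_sum_hasseCoeff_smul_hasseDeriv (show IsDiffOpLE K n E from hE)]
    exact Submodule.sum_mem _ fun q hq =>
      Submodule.smul_mem _ _ (Submodule.subset_span ⟨q, hq, rfl⟩)
  · rintro _ ⟨q, hq, rfl⟩
    exact polyHasseDeriv_mem_diffOp (Nat.lt_succ_iff.mp (Finset.mem_range.mp hq))

/-- **Differential ideals on the affine line are computed on Hasse derivatives**:
`Diff^{≤ n}(I) ⊆ J ↔ D^{(q)} f ∈ J` for all `q ≤ n` and `f ∈ I` (the tree's `diffIdeal`).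
[cite: EGAIV4, Thm. 16.11.2] -/
theorem diffIdeal_polynomial_le_iff {n : ℕ} {I J : Ideal K[X]} :
    diffIdeal K n I ≤ J ↔ ∀ q ≤ n, ∀ f ∈ I, hasseDeriv q f ∈ J := by
  rw [diffIdeal_le_iff]
  constructor
  · intro h q hq f hf
    exact h _ (isDiffOpLE_polyHasseDeriv n q hq) f hf
  · intro h E hE f hf
    rw [apply_eq_sum_hasseCoeff_mul_hasseDeriv hE]
    exact J.sum_mem fun q hq =>
      Ideal.mul_mem_left _ _ (h q (Nat.lt_succ_iff.mp (Finset.mem_range.mp hq)) f hf)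

/-- In particular `Diff^{≤ n}((f)) ⊆ J ↔ D^{(q)}(h f) ∈ J` for all `q ≤ n`, `h ∈ K[X]` (principal ideals).
[cite: EGAIV4, Thm. 16.11.2] -/
theorem diffIdeal_polynomial_span_singleton_le_iff {n : ℕ} {f : K[X]} {J : Ideal K[X]} :
    diffIdeal K n (Ideal.span {f}) ≤ J ↔ ∀ q ≤ n, ∀ h : K[X], hasseDeriv q (h * f) ∈ J := by
  rw [diffIdeal_polynomial_le_iff]
  constructor
  · intro H q hq h
    exact H q hq _ (Ideal.mem_span_singleton'.mpr ⟨h, rfl⟩)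
  · intro H q hq g hg
    obtain ⟨h, rfl⟩ := Ideal.mem_span_singleton'.mp hg
    exact H q hq h

end Literature.AlgebraicGeometry.Resolution

end
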